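import Summits.QuantumFields.YangMills.Theorems.BalabanUVNodesN15KingModelFreeRGGaussNorm
import HarnessLib

/-!
# BalabanUVNodes ∕ N15 — THE KING-MODEL RUNG, FREE-FIELD EDITION (PART Τ-b): THE GAUSSIAN LARGE-FIELD ESTIMATE — Chernoff's bound for one
# coordinate of the density `ρ_Δ = e^{−½⟨x,Δx⟩}∕𝒩(Δ)` from the TILT identity, `∫_{x_i ≥ R} ρ_Δ ≤ e^{−R²∕(2G)}` for `⟨e_i, Δ⁻¹e_i⟩ ≤ G`, and the
# UNION bound `∫ (1 − χ_R) ρ_Δ ≤ 2|ι|·e^{−R²∕(2G)}` for the box `χ_R = 𝟙[∀ i, |x_i| ≤ R]` — the measure-theoretic half of [King1986] Thm 3.1 (3.4)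
# for the free field (Track A, DAG node N15 = NE2; FAN-OUT v1.1 §N15 s3 «KING-MODEL RUNG»; regen R453 (b))

HONEST FRAMING.  Count-neutral (cell `pub-ymgap`, seat `pub-ymgap-dag-n15-e` g19; `--supports stmt-QuantumFields-27366 --as helper` = K3⁸
`SpineGivenEndpointR13SepCoPHV`).  PURE MEASURE THEORY ∕ PROBABILITY on `ι → ℝ` with Lebesgue measure (Mathlib), continuing part Τ-a; no King
object, no record key.  WHY: King's Theorem 3.1 (3.3)–(3.4) p. 655 squeezes `Z^{ε_K}` between the small-field integral `∫χ_k e^{−S^{(k),1}}` and the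
same plus the large-field remainder `exp[−p(L^kε_K)² + C|T|]`; for the free field `e^{−S^{(k),1}} = ρ_{Δ^{(k)}}` IS a centred Gaussian probability density
(part Τ-e), so (3.4) is the statement that the Gaussian mass of the LARGE-FIELD region `{∃y : |φ_k(y)| > R}` is at most `exp[−p² + C|T|]`.  This file
proves the model-free estimate behind it: the exponential Chebyshev (Chernoff) bound per coordinate, fed by part Τ-a's tilt identity
`∫e^{⟨J,x⟩}ρ_Δ = e^{½⟨J,Δ⁻¹J⟩}` (no determinant, no marginal density), optimised at `t = R∕G`, and the union bound over the sites.  Part Τ-g combines it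
with part Τ-c's bound on the diagonal of `(Δ^{(k)})⁻¹`.  NOT a node discharge; nothing continuum-YM ∕ ℝ⁴ ∕ OS ∕ mass-gap ∕ Clay.  0 `sorry`, 0 `def`;
standard axioms.
Locators: [King1986] (3.2) p.655 (the small-field region), Thm 3.1 (3.4) p.655 (the large-field remainder `exp[−p(L^kε_K)² + C|T|]`).
-/

noncomputable section

namespace Summit.QuantumFields.YangMills.BalabanUVNodes.N15KingModelRung.FreeField

open Real Finset Matrix MeasureTheory
open Literature.MathematicalPhysics.QuantumFieldTheory.Balaban1983to89.QGQInverse (Coercive isUnit_of_coercive)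
open Literature.LinearAlgebra.Matrix (dotProduct_self_nonneg_real)

variable {ι : Type*} [Fintype ι]

/-! ## §1 The centred Gaussian density `ρ_Δ` and its integrability letters -/

/-- `ρ_Δ ≥ 0`. [folklore] -/
theorem gaussDensity_nonneg {Δ : Matrix ι ι ℝ} {δ : ℝ} (hδ : 0 < δ) (hΔ : Coercive Δ δ) (x : ι → ℝ) :
    0 ≤ Real.exp (-(1 / 2 : ℝ) * (x ⬝ᵥ (Δ *ᵥ x))) / gaussNorm Δ :=
  div_nonneg (Real.exp_pos _).le (gaussNorm_pos hδ hΔ).le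

/-- `ρ_Δ` is integrable. [folklore] -/
theorem integrable_gaussDensity {Δ : Matrix ι ι ℝ} {δ : ℝ} (hδ : 0 < δ) (hΔ : Coercive Δ δ) :
    Integrable (fun x : ι → ℝ => Real.exp (-(1 / 2 : ℝ) * (x ⬝ᵥ (Δ *ᵥ x))) / gaussNorm Δ) :=
  (integrable_gauss hδ hΔ).div_const _

/-- The tilted density `e^{⟨J,x⟩}ρ_Δ` is integrable. [folklore] -/
theorem integrable_exp_dot_gaussDensity {Δ : Matrix ι ι ℝ} {δ : ℝ} (hδ : 0 < δ) (hΔ : Coercive Δ δ) (J : ι → ℝ) :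
    Integrable (fun x : ι → ℝ => Real.exp (J ⬝ᵥ x) * (Real.exp (-(1 / 2 : ℝ) * (x ⬝ᵥ (Δ *ᵥ x))) / gaussNorm Δ)) := by
  have h := (integrable_gaussTilt hδ hΔ J).div_const (gaussNorm Δ)
  refine h.congr (Filter.Eventually.of_forall fun x => ?_)
  simp only
  rw [Real.exp_add]
  ring

/-! ## §2 Chernoff's bound for one coordinate (upper and lower tail) -/

omit [Fintype ι] in
/-- The indicator of `{R ≤ x_i}` is measurable. [folklore] -/
theorem measurable_indicator_ge (i : ι) (R : ℝ) :
    Measurable fun x : ι → ℝ => Set.indicator {x : ι → ℝ | R ≤ x i} (fun _ => (1 : ℝ)) x :=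
  measurable_const.indicator (measurableSet_le measurable_const (measurable_pi_apply i))

omit [Fintype ι] in
/-- The indicator of `{x_i ≤ −R}` is measurable. [folklore] -/
theorem measurable_indicator_le (i : ι) (R : ℝ) :
    Measurable fun x : ι → ℝ => Set.indicator {x : ι → ℝ | x i ≤ -R} (fun _ => (1 : ℝ)) x :=
  measurable_const.indicator (measurableSet_le (measurable_pi_apply i) measurable_const)

/-- The exponential Chebyshev letter: `𝟙[R ≤ y] ≤ e^{t(y − R)}` for `t ≥ 0`. [folklore] -/
theorem indicator_ge_le_exp {R t y : ℝ} (ht : 0 ≤ t) :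
    Set.indicator {y : ℝ | R ≤ y} (fun _ => (1 : ℝ)) y ≤ Real.exp (t * (y - R)) := by
  by_cases h : R ≤ y
  · rw [Set.indicator_of_mem (show y ∈ {y : ℝ | R ≤ y} from h)]
    exact Real.one_le_exp (mul_nonneg ht (by linarith))
  · rw [Set.indicator_of_notMem (show y ∉ {y : ℝ | R ≤ y} from h)]
    exact (Real.exp_pos _).le

/-- `(t·e_i) ⬝ᵥ x = t·x_i`. [folklore] -/
theorem smul_single_dotProduct [DecidableEq ι] (i : ι) (t : ℝ) (x : ι → ℝ) : (t • Pi.single i (1 : ℝ)) ⬝ᵥ x = t * x i := by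
  rw [smul_dotProduct, single_dotProduct, one_mul, smul_eq_mul]

/-- `⟨tJ, Δ⁻¹(tJ)⟩ = t²⟨J, Δ⁻¹J⟩`. [folklore] -/
theorem quad_inv_smul [DecidableEq ι] (Δ : Matrix ι ι ℝ) (t : ℝ) (J : ι → ℝ) :
    (t • J) ⬝ᵥ (Δ⁻¹ *ᵥ (t • J)) = t ^ 2 * (J ⬝ᵥ (Δ⁻¹ *ᵥ J)) := by
  rw [Matrix.mulVec_smul, smul_dotProduct, dotProduct_smul, smul_eq_mul, smul_eq_mul]; ring

/-- **CHERNOFF, UPPER TAIL**: for symmetric coercive `Δ`, `t ≥ 0`, site `i`, level `R`: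
`∫ 𝟙[R ≤ x_i] ρ_Δ(x) dx ≤ exp(−tR + ½t²⟨e_i, Δ⁻¹e_i⟩)` (Markov on `e^{t x_i}` and the tilt identity of part Τ-a). [folklore] -/
theorem gauss_upperTail_le [DecidableEq ι] {Δ : Matrix ι ι ℝ} {δ : ℝ} (hδ : 0 < δ) (hΔ : Coercive Δ δ) (hsymm : Δᵀ = Δ) (i : ι) (R : ℝ) {t : ℝ} (ht : 0 ≤ t) :
    ∫ x : ι → ℝ, Set.indicator {x : ι → ℝ | R ≤ x i} (fun _ => (1 : ℝ)) x * (Real.exp (-(1 / 2 : ℝ) * (x ⬝ᵥ (Δ *ᵥ x))) / gaussNorm Δ)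
      ≤ Real.exp (-(t * R) + (1 / 2 : ℝ) * t ^ 2 * (Pi.single i (1 : ℝ) ⬝ᵥ (Δ⁻¹ *ᵥ Pi.single i 1))) := by
  set J : ι → ℝ := t • Pi.single i (1 : ℝ) with hJ
  have hρ := integrable_gaussDensity hδ hΔ
  have hρ0 := gaussDensity_nonneg hδ hΔ
  -- integrability of the indicator-weighted density
  have hind : Integrable (fun x : ι → ℝ => Set.indicator {x : ι → ℝ | R ≤ x i} (fun _ => (1 : ℝ)) x
      * (Real.exp (-(1 / 2 : ℝ) * (x ⬝ᵥ (Δ *ᵥ x))) / gaussNorm Δ)) := by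
    refine hρ.mono ((measurable_indicator_ge i R).aestronglyMeasurable.mul hρ.aestronglyMeasurable) ?_
    refine Filter.Eventually.of_forall fun x => ?_
    rw [Real.norm_eq_abs, Real.norm_eq_abs, abs_mul, abs_of_nonneg (hρ0 x)]
    have h1 : |Set.indicator {x : ι → ℝ | R ≤ x i} (fun _ => (1 : ℝ)) x| ≤ 1 := by
      by_cases h : x ∈ {x : ι → ℝ | R ≤ x i}
      · rw [Set.indicator_of_mem h, abs_one]
      · rw [Set.indicator_of_notMem h, abs_zero]; exact zero_le_one
    calc |Set.indicator {x : ι → ℝ | R ≤ x i} (fun _ => (1 : ℝ)) x| * (Real.exp (-(1 / 2 : ℝ) * (x ⬝ᵥ (Δ *ᵥ x))) / gaussNorm Δ)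
        ≤ 1 * (Real.exp (-(1 / 2 : ℝ) * (x ⬝ᵥ (Δ *ᵥ x))) / gaussNorm Δ) := mul_le_mul_of_nonneg_right h1 (hρ0 x)
      _ = _ := by rw [one_mul]
  -- the tilted density, scaled by e^{−tR}
  have htilt := integrable_exp_dot_gaussDensity hδ hΔ J
  have hdom : ∀ x : ι → ℝ, Set.indicator {x : ι → ℝ | R ≤ x i} (fun _ => (1 : ℝ)) x * (Real.exp (-(1 / 2 : ℝ) * (x ⬝ᵥ (Δ *ᵥ x))) / gaussNorm Δ)
      ≤ Real.exp (-(t * R)) * (Real.exp (J ⬝ᵥ x) * (Real.exp (-(1 / 2 : ℝ) * (x ⬝ᵥ (Δ *ᵥ x))) / gaussNorm Δ)) := by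
    intro x
    have hind1 : Set.indicator {x : ι → ℝ | R ≤ x i} (fun _ => (1 : ℝ)) x = Set.indicator {y : ℝ | R ≤ y} (fun _ => (1 : ℝ)) (x i) := by
      by_cases h : R ≤ x i
      · rw [Set.indicator_of_mem (show x ∈ {x : ι → ℝ | R ≤ x i} from h), Set.indicator_of_mem (show x i ∈ {y : ℝ | R ≤ y} from h)]
      · rw [Set.indicator_of_notMem (show x ∉ {x : ι → ℝ | R ≤ x i} from h), Set.indicator_of_notMem (show x i ∉ {y : ℝ | R ≤ y} from h)]
    have h1 := indicator_ge_le_exp (R := R) (y := x i) ht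
    rw [← hind1] at h1
    have h2 : Real.exp (t * (x i - R)) = Real.exp (-(t * R)) * Real.exp (J ⬝ᵥ x) := by
      rw [← Real.exp_add, hJ, smul_single_dotProduct]; ring_nf
    calc Set.indicator {x : ι → ℝ | R ≤ x i} (fun _ => (1 : ℝ)) x * (Real.exp (-(1 / 2 : ℝ) * (x ⬝ᵥ (Δ *ᵥ x))) / gaussNorm Δ)
        ≤ Real.exp (t * (x i - R)) * (Real.exp (-(1 / 2 : ℝ) * (x ⬝ᵥ (Δ *ᵥ x))) / gaussNorm Δ) := mul_le_mul_of_nonneg_right h1 (hρ0 x)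
      _ = _ := by rw [h2, mul_assoc]
  calc ∫ x : ι → ℝ, Set.indicator {x : ι → ℝ | R ≤ x i} (fun _ => (1 : ℝ)) x * (Real.exp (-(1 / 2 : ℝ) * (x ⬝ᵥ (Δ *ᵥ x))) / gaussNorm Δ)
      ≤ ∫ x : ι → ℝ, Real.exp (-(t * R)) * (Real.exp (J ⬝ᵥ x) * (Real.exp (-(1 / 2 : ℝ) * (x ⬝ᵥ (Δ *ᵥ x))) / gaussNorm Δ)) :=
        integral_mono hind (htilt.const_mul _) hdom
    _ = Real.exp (-(t * R)) * Real.exp ((1 / 2 : ℝ) * (J ⬝ᵥ (Δ⁻¹ *ᵥ J))) := by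
        rw [integral_const_mul, integral_exp_dot_gaussDensity hδ hΔ hsymm J]
    _ = _ := by rw [← Real.exp_add, hJ, quad_inv_smul]; ring_nf

/-- **CHERNOFF, LOWER TAIL**: `∫ 𝟙[x_i ≤ −R] ρ_Δ(x) dx ≤ exp(−tR + ½t²⟨e_i, Δ⁻¹e_i⟩)` (the tilt `J = −t e_i`). [folklore] -/
theorem gauss_lowerTail_le [DecidableEq ι] {Δ : Matrix ι ι ℝ} {δ : ℝ} (hδ : 0 < δ) (hΔ : Coercive Δ δ) (hsymm : Δᵀ = Δ) (i : ι) (R : ℝ) {t : ℝ} (ht : 0 ≤ t) :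
    ∫ x : ι → ℝ, Set.indicator {x : ι → ℝ | x i ≤ -R} (fun _ => (1 : ℝ)) x * (Real.exp (-(1 / 2 : ℝ) * (x ⬝ᵥ (Δ *ᵥ x))) / gaussNorm Δ)
      ≤ Real.exp (-(t * R) + (1 / 2 : ℝ) * t ^ 2 * (Pi.single i (1 : ℝ) ⬝ᵥ (Δ⁻¹ *ᵥ Pi.single i 1))) := by
  set J : ι → ℝ := (-t) • Pi.single i (1 : ℝ) with hJ
  have hρ := integrable_gaussDensity hδ hΔ
  have hρ0 := gaussDensity_nonneg hδ hΔ
  have hind : Integrable (fun x : ι → ℝ => Set.indicator {x : ι → ℝ | x i ≤ -R} (fun _ => (1 : ℝ)) x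
      * (Real.exp (-(1 / 2 : ℝ) * (x ⬝ᵥ (Δ *ᵥ x))) / gaussNorm Δ)) := by
    refine hρ.mono ((measurable_indicator_le i R).aestronglyMeasurable.mul hρ.aestronglyMeasurable) ?_
    refine Filter.Eventually.of_forall fun x => ?_
    rw [Real.norm_eq_abs, Real.norm_eq_abs, abs_mul, abs_of_nonneg (hρ0 x)]
    have h1 : |Set.indicator {x : ι → ℝ | x i ≤ -R} (fun _ => (1 : ℝ)) x| ≤ 1 := by
      by_cases h : x ∈ {x : ι → ℝ | x i ≤ -R}
      · rw [Set.indicator_of_mem h, abs_one]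
      · rw [Set.indicator_of_notMem h, abs_zero]; exact zero_le_one
    calc |Set.indicator {x : ι → ℝ | x i ≤ -R} (fun _ => (1 : ℝ)) x| * (Real.exp (-(1 / 2 : ℝ) * (x ⬝ᵥ (Δ *ᵥ x))) / gaussNorm Δ)
        ≤ 1 * (Real.exp (-(1 / 2 : ℝ) * (x ⬝ᵥ (Δ *ᵥ x))) / gaussNorm Δ) := mul_le_mul_of_nonneg_right h1 (hρ0 x)
      _ = _ := by rw [one_mul]
  have htilt := integrable_exp_dot_gaussDensity hδ hΔ J
  have hdom : ∀ x : ι → ℝ, Set.indicator {x : ι → ℝ | x i ≤ -R} (fun _ => (1 : ℝ)) x * (Real.exp (-(1 / 2 : ℝ) * (x ⬝ᵥ (Δ *ᵥ x))) / gaussNorm Δ)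
      ≤ Real.exp (-(t * R)) * (Real.exp (J ⬝ᵥ x) * (Real.exp (-(1 / 2 : ℝ) * (x ⬝ᵥ (Δ *ᵥ x))) / gaussNorm Δ)) := by
    intro x
    -- 𝟙[x_i ≤ −R] = 𝟙[R ≤ −x_i] ≤ e^{t(−x_i − R)}
    have hind1 : Set.indicator {x : ι → ℝ | x i ≤ -R} (fun _ => (1 : ℝ)) x = Set.indicator {y : ℝ | R ≤ y} (fun _ => (1 : ℝ)) (-x i) := by
      by_cases h : x i ≤ -R
      · have h' : R ≤ -x i := by linarith
        rw [Set.indicator_of_mem (show x ∈ {x : ι → ℝ | x i ≤ -R} from h), Set.indicator_of_mem (show -x i ∈ {y : ℝ | R ≤ y} from h')]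
      · have h' : ¬ R ≤ -x i := fun h' => h (by linarith)
        rw [Set.indicator_of_notMem (show x ∉ {x : ι → ℝ | x i ≤ -R} from h), Set.indicator_of_notMem (show -x i ∉ {y : ℝ | R ≤ y} from h')]
    have h1 := indicator_ge_le_exp (R := R) (y := -x i) ht
    rw [← hind1] at h1
    have h2 : Real.exp (t * (-x i - R)) = Real.exp (-(t * R)) * Real.exp (J ⬝ᵥ x) := by
      rw [← Real.exp_add, hJ, smul_single_dotProduct]; ring_nf
    calc Set.indicator {x : ι → ℝ | x i ≤ -R} (fun _ => (1 : ℝ)) x * (Real.exp (-(1 / 2 : ℝ) * (x ⬝ᵥ (Δ *ᵥ x))) / gaussNorm Δ)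
        ≤ Real.exp (t * (-x i - R)) * (Real.exp (-(1 / 2 : ℝ) * (x ⬝ᵥ (Δ *ᵥ x))) / gaussNorm Δ) := mul_le_mul_of_nonneg_right h1 (hρ0 x)
      _ = _ := by rw [h2, mul_assoc]
  calc ∫ x : ι → ℝ, Set.indicator {x : ι → ℝ | x i ≤ -R} (fun _ => (1 : ℝ)) x * (Real.exp (-(1 / 2 : ℝ) * (x ⬝ᵥ (Δ *ᵥ x))) / gaussNorm Δ)
      ≤ ∫ x : ι → ℝ, Real.exp (-(t * R)) * (Real.exp (J ⬝ᵥ x) * (Real.exp (-(1 / 2 : ℝ) * (x ⬝ᵥ (Δ *ᵥ x))) / gaussNorm Δ)) :=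
        integral_mono hind (htilt.const_mul _) hdom
    _ = Real.exp (-(t * R)) * Real.exp ((1 / 2 : ℝ) * (J ⬝ᵥ (Δ⁻¹ *ᵥ J))) := by
        rw [integral_const_mul, integral_exp_dot_gaussDensity hδ hΔ hsymm J]
    _ = _ := by rw [← Real.exp_add, hJ, quad_inv_smul]; ring_nf

/-! ## §3 The optimised bound `e^{−R²∕(2G)}` for any upper bound `G` on `⟨e_i, Δ⁻¹e_i⟩` -/

/-- The optimisation letter: with `t = R∕G` (`R ≥ 0`, `0 < G`, `g ≤ G`), `−tR + ½t²g ≤ −R²∕(2G)`. [folklore] -/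
theorem chernoff_exponent_le {R G g : ℝ} (hG : 0 < G) (hg : g ≤ G) :
    -(R / G * R) + (1 / 2 : ℝ) * (R / G) ^ 2 * g ≤ -(R ^ 2 / (2 * G)) := by
  have h1 : (1 / 2 : ℝ) * (R / G) ^ 2 * g ≤ (1 / 2 : ℝ) * (R / G) ^ 2 * G := mul_le_mul_of_nonneg_left hg (by positivity)
  have h2 : -(R / G * R) + (1 / 2 : ℝ) * (R / G) ^ 2 * G = -(R ^ 2 / (2 * G)) := by field_simp; ring
  linarith

/-- ★ **BOTH TAILS of one coordinate**: for symmetric coercive `Δ`, `0 ≤ R`, `⟨e_i, Δ⁻¹e_i⟩ ≤ G`, `0 < G`: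
`∫ 𝟙[R ≤ x_i] ρ_Δ + ∫ 𝟙[x_i ≤ −R] ρ_Δ ≤ 2e^{−R²∕(2G)}`. [folklore] -/
theorem gauss_twoTails_le [DecidableEq ι] {Δ : Matrix ι ι ℝ} {δ : ℝ} (hδ : 0 < δ) (hΔ : Coercive Δ δ) (hsymm : Δᵀ = Δ) (i : ι) {R G : ℝ} (hR : 0 ≤ R)
    (hG : 0 < G) (hGi : Pi.single i (1 : ℝ) ⬝ᵥ (Δ⁻¹ *ᵥ Pi.single i 1) ≤ G) :
    (∫ x : ι → ℝ, Set.indicator {x : ι → ℝ | R ≤ x i} (fun _ => (1 : ℝ)) x * (Real.exp (-(1 / 2 : ℝ) * (x ⬝ᵥ (Δ *ᵥ x))) / gaussNorm Δ))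
      + ∫ x : ι → ℝ, Set.indicator {x : ι → ℝ | x i ≤ -R} (fun _ => (1 : ℝ)) x * (Real.exp (-(1 / 2 : ℝ) * (x ⬝ᵥ (Δ *ᵥ x))) / gaussNorm Δ)
      ≤ 2 * Real.exp (-(R ^ 2 / (2 * G))) := by
  have ht : 0 ≤ R / G := div_nonneg hR hG.le
  have hexp := chernoff_exponent_le (R := R) hG hGi
  have h1 := (gauss_upperTail_le hδ hΔ hsymm i R ht).trans (Real.exp_le_exp.mpr hexp)
  have h2 := (gauss_lowerTail_le hδ hΔ hsymm i R ht).trans (Real.exp_le_exp.mpr hexp)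
  linarith

/-! ## §4 ★ The union bound over the sites: the Gaussian mass of the large-field region -/

/-- The complement of the small-field box is covered by the one-coordinate tails:
`1 − 𝟙[∀ i, |x_i| ≤ R] ≤ Σ_i (𝟙[R ≤ x_i] + 𝟙[x_i ≤ −R])`. [folklore] -/
theorem one_sub_box_le_sum (R : ℝ) (x : ι → ℝ) :
    1 - (if ∀ i, |x i| ≤ R then (1 : ℝ) else 0)
      ≤ ∑ i, (Set.indicator {x : ι → ℝ | R ≤ x i} (fun _ => (1 : ℝ)) x + Set.indicator {x : ι → ℝ | x i ≤ -R} (fun _ => (1 : ℝ)) x) := by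
  have hnn : ∀ i, 0 ≤ Set.indicator {x : ι → ℝ | R ≤ x i} (fun _ => (1 : ℝ)) x + Set.indicator {x : ι → ℝ | x i ≤ -R} (fun _ => (1 : ℝ)) x :=
    fun i => add_nonneg (Set.indicator_nonneg (fun _ _ => zero_le_one) _) (Set.indicator_nonneg (fun _ _ => zero_le_one) _)
  split_ifs with h
  · simp only [sub_self]
    exact Finset.sum_nonneg fun i _ => hnn i
  · push Not at h
    obtain ⟨i, hi⟩ := h
    rw [sub_zero]
    refine le_trans ?_ (Finset.single_le_sum (fun j _ => hnn j) (Finset.mem_univ i))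
    -- |x_i| > R ⇒ one of the two indicators at i is 1
    rcases le_or_gt 0 (x i) with hx | hx
    · have hmem : x ∈ {x : ι → ℝ | R ≤ x i} := by
        show R ≤ x i; rw [abs_of_nonneg hx] at hi; exact hi.le
      rw [Set.indicator_of_mem hmem]
      linarith [Set.indicator_nonneg (fun _ _ => (zero_le_one : (0 : ℝ) ≤ 1)) (s := {x : ι → ℝ | x i ≤ -R}) x]
    · have hmem : x ∈ {x : ι → ℝ | x i ≤ -R} := by
        show x i ≤ -R; rw [abs_of_neg hx] at hi; linarith
      rw [Set.indicator_of_mem hmem]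
      linarith [Set.indicator_nonneg (fun _ _ => (zero_le_one : (0 : ℝ) ≤ 1)) (s := {x : ι → ℝ | R ≤ x i}) x]

open Classical in
/-- The box indicator is measurable. [folklore] -/
theorem measurable_box (R : ℝ) : Measurable fun x : ι → ℝ => if ∀ i, |x i| ≤ R then (1 : ℝ) else 0 := by
  refine Measurable.ite ?_ measurable_const measurable_const
  have : {x : ι → ℝ | ∀ i, |x i| ≤ R} = ⋂ i, {x : ι → ℝ | |x i| ≤ R} := by ext x; simp
  rw [this]
  exact MeasurableSet.iInter fun i => measurableSet_le ((measurable_pi_apply i).abs) measurable_const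

/-- ★ **THE GAUSSIAN MASS OF THE LARGE-FIELD REGION**: for symmetric coercive `Δ` on `ℝ^ι`, `R ≥ 0`, and `G > 0` with `⟨e_i, Δ⁻¹e_i⟩ ≤ G` for all
sites `i`: `∫ (1 − 𝟙[∀ i, |x_i| ≤ R]) ρ_Δ(x) dx ≤ 2|ι|·e^{−R²∕(2G)}` — the shape of (3.4)'s remainder once `R²∕(2G) ≥ p(L^kε)² + ln(2|T₁^{(k)}|)`.
[cite: King1986, Thm 3.1 (3.4) p.655] -/
theorem largeField_mass_le [DecidableEq ι] {Δ : Matrix ι ι ℝ} {δ : ℝ} (hδ : 0 < δ) (hΔ : Coercive Δ δ) (hsymm : Δᵀ = Δ) {R G : ℝ} (hR : 0 ≤ R) (hG : 0 < G)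
    (hGi : ∀ i, Pi.single i (1 : ℝ) ⬝ᵥ (Δ⁻¹ *ᵥ Pi.single i 1) ≤ G) :
    ∫ x : ι → ℝ, (1 - (if ∀ i, |x i| ≤ R then (1 : ℝ) else 0)) * (Real.exp (-(1 / 2 : ℝ) * (x ⬝ᵥ (Δ *ᵥ x))) / gaussNorm Δ)
      ≤ 2 * Fintype.card ι * Real.exp (-(R ^ 2 / (2 * G))) := by
  have hρ := integrable_gaussDensity hδ hΔ
  have hρ0 := gaussDensity_nonneg hδ hΔ
  -- integrability of every summand
  have hindU : ∀ i, Integrable (fun x : ι → ℝ => Set.indicator {x : ι → ℝ | R ≤ x i} (fun _ => (1 : ℝ)) x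
      * (Real.exp (-(1 / 2 : ℝ) * (x ⬝ᵥ (Δ *ᵥ x))) / gaussNorm Δ)) := fun i => by
    refine hρ.mono ((measurable_indicator_ge i R).aestronglyMeasurable.mul hρ.aestronglyMeasurable) (Filter.Eventually.of_forall fun x => ?_)
    rw [Real.norm_eq_abs, Real.norm_eq_abs, abs_mul, abs_of_nonneg (hρ0 x)]
    have h1 : |Set.indicator {x : ι → ℝ | R ≤ x i} (fun _ => (1 : ℝ)) x| ≤ 1 := by
      by_cases h : x ∈ {x : ι → ℝ | R ≤ x i}
      · rw [Set.indicator_of_mem h, abs_one]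
      · rw [Set.indicator_of_notMem h, abs_zero]; exact zero_le_one
    calc |Set.indicator {x : ι → ℝ | R ≤ x i} (fun _ => (1 : ℝ)) x| * (Real.exp (-(1 / 2 : ℝ) * (x ⬝ᵥ (Δ *ᵥ x))) / gaussNorm Δ)
        ≤ 1 * _ := mul_le_mul_of_nonneg_right h1 (hρ0 x)
      _ = _ := by rw [one_mul]
  have hindL : ∀ i, Integrable (fun x : ι → ℝ => Set.indicator {x : ι → ℝ | x i ≤ -R} (fun _ => (1 : ℝ)) x
      * (Real.exp (-(1 / 2 : ℝ) * (x ⬝ᵥ (Δ *ᵥ x))) / gaussNorm Δ)) := fun i => by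
    refine hρ.mono ((measurable_indicator_le i R).aestronglyMeasurable.mul hρ.aestronglyMeasurable) (Filter.Eventually.of_forall fun x => ?_)
    rw [Real.norm_eq_abs, Real.norm_eq_abs, abs_mul, abs_of_nonneg (hρ0 x)]
    have h1 : |Set.indicator {x : ι → ℝ | x i ≤ -R} (fun _ => (1 : ℝ)) x| ≤ 1 := by
      by_cases h : x ∈ {x : ι → ℝ | x i ≤ -R}
      · rw [Set.indicator_of_mem h, abs_one]
      · rw [Set.indicator_of_notMem h, abs_zero]; exact zero_le_one
    calc |Set.indicator {x : ι → ℝ | x i ≤ -R} (fun _ => (1 : ℝ)) x| * (Real.exp (-(1 / 2 : ℝ) * (x ⬝ᵥ (Δ *ᵥ x))) / gaussNorm Δ)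
        ≤ 1 * _ := mul_le_mul_of_nonneg_right h1 (hρ0 x)
      _ = _ := by rw [one_mul]
  -- pointwise regrouping `(Σ_i (𝟙 + 𝟙))·ρ = Σ_i (𝟙ρ + 𝟙ρ)`
  have e : ∀ x : ι → ℝ, (∑ i, (Set.indicator {x : ι → ℝ | R ≤ x i} (fun _ => (1 : ℝ)) x + Set.indicator {x : ι → ℝ | x i ≤ -R} (fun _ => (1 : ℝ)) x))
      * (Real.exp (-(1 / 2 : ℝ) * (x ⬝ᵥ (Δ *ᵥ x))) / gaussNorm Δ)
      = ∑ i, (Set.indicator {x : ι → ℝ | R ≤ x i} (fun _ => (1 : ℝ)) x * (Real.exp (-(1 / 2 : ℝ) * (x ⬝ᵥ (Δ *ᵥ x))) / gaussNorm Δ)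
        + Set.indicator {x : ι → ℝ | x i ≤ -R} (fun _ => (1 : ℝ)) x * (Real.exp (-(1 / 2 : ℝ) * (x ⬝ᵥ (Δ *ᵥ x))) / gaussNorm Δ)) := by
    intro x; rw [Finset.sum_mul]; exact Finset.sum_congr rfl fun i _ => by ring
  have hsum : Integrable (fun x : ι → ℝ => (∑ i, (Set.indicator {x : ι → ℝ | R ≤ x i} (fun _ => (1 : ℝ)) x
      + Set.indicator {x : ι → ℝ | x i ≤ -R} (fun _ => (1 : ℝ)) x)) * (Real.exp (-(1 / 2 : ℝ) * (x ⬝ᵥ (Δ *ᵥ x))) / gaussNorm Δ)) := by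
    have : (fun x : ι → ℝ => (∑ i, (Set.indicator {x : ι → ℝ | R ≤ x i} (fun _ => (1 : ℝ)) x
        + Set.indicator {x : ι → ℝ | x i ≤ -R} (fun _ => (1 : ℝ)) x)) * (Real.exp (-(1 / 2 : ℝ) * (x ⬝ᵥ (Δ *ᵥ x))) / gaussNorm Δ))
        = fun x => ∑ i, (Set.indicator {x : ι → ℝ | R ≤ x i} (fun _ => (1 : ℝ)) x * (Real.exp (-(1 / 2 : ℝ) * (x ⬝ᵥ (Δ *ᵥ x))) / gaussNorm Δ)
          + Set.indicator {x : ι → ℝ | x i ≤ -R} (fun _ => (1 : ℝ)) x * (Real.exp (-(1 / 2 : ℝ) * (x ⬝ᵥ (Δ *ᵥ x))) / gaussNorm Δ)) := by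
      funext x; exact e x
    rw [this]
    have hFi : ∀ i, Integrable (fun x : ι → ℝ =>
        Set.indicator {x : ι → ℝ | R ≤ x i} (fun _ => (1 : ℝ)) x * (Real.exp (-(1 / 2 : ℝ) * (x ⬝ᵥ (Δ *ᵥ x))) / gaussNorm Δ)
          + Set.indicator {x : ι → ℝ | x i ≤ -R} (fun _ => (1 : ℝ)) x * (Real.exp (-(1 / 2 : ℝ) * (x ⬝ᵥ (Δ *ᵥ x))) / gaussNorm Δ)) :=
      fun i => (hindU i).add (hindL i)
    exact integrable_finsetSum _ fun i _ => hFi i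
  -- the large-field integrand is integrable and dominated pointwise
  have hLF : Integrable (fun x : ι → ℝ => (1 - (if ∀ i, |x i| ≤ R then (1 : ℝ) else 0))
      * (Real.exp (-(1 / 2 : ℝ) * (x ⬝ᵥ (Δ *ᵥ x))) / gaussNorm Δ)) := by
    refine hρ.mono ((measurable_const.sub (measurable_box R)).aestronglyMeasurable.mul hρ.aestronglyMeasurable)
      (Filter.Eventually.of_forall fun x => ?_)
    rw [Real.norm_eq_abs, Real.norm_eq_abs, abs_mul, abs_of_nonneg (hρ0 x)]
    have h1 : |1 - (if ∀ i, |x i| ≤ R then (1 : ℝ) else 0)| ≤ 1 := by split_ifs <;> norm_num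
    calc |1 - (if ∀ i, |x i| ≤ R then (1 : ℝ) else 0)| * (Real.exp (-(1 / 2 : ℝ) * (x ⬝ᵥ (Δ *ᵥ x))) / gaussNorm Δ)
        ≤ 1 * _ := mul_le_mul_of_nonneg_right h1 (hρ0 x)
      _ = _ := by rw [one_mul]
  calc ∫ x : ι → ℝ, (1 - (if ∀ i, |x i| ≤ R then (1 : ℝ) else 0)) * (Real.exp (-(1 / 2 : ℝ) * (x ⬝ᵥ (Δ *ᵥ x))) / gaussNorm Δ)
      ≤ ∫ x : ι → ℝ, (∑ i, (Set.indicator {x : ι → ℝ | R ≤ x i} (fun _ => (1 : ℝ)) x + Set.indicator {x : ι → ℝ | x i ≤ -R} (fun _ => (1 : ℝ)) x))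
          * (Real.exp (-(1 / 2 : ℝ) * (x ⬝ᵥ (Δ *ᵥ x))) / gaussNorm Δ) :=
        integral_mono hLF hsum fun x => mul_le_mul_of_nonneg_right (one_sub_box_le_sum R x) (hρ0 x)
    _ = ∑ i, ((∫ x : ι → ℝ, Set.indicator {x : ι → ℝ | R ≤ x i} (fun _ => (1 : ℝ)) x * (Real.exp (-(1 / 2 : ℝ) * (x ⬝ᵥ (Δ *ᵥ x))) / gaussNorm Δ))
          + ∫ x : ι → ℝ, Set.indicator {x : ι → ℝ | x i ≤ -R} (fun _ => (1 : ℝ)) x * (Real.exp (-(1 / 2 : ℝ) * (x ⬝ᵥ (Δ *ᵥ x))) / gaussNorm Δ)) := by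
        simp_rw [e]
        have hFi : ∀ i, Integrable (fun x : ι → ℝ =>
            Set.indicator {x : ι → ℝ | R ≤ x i} (fun _ => (1 : ℝ)) x * (Real.exp (-(1 / 2 : ℝ) * (x ⬝ᵥ (Δ *ᵥ x))) / gaussNorm Δ)
              + Set.indicator {x : ι → ℝ | x i ≤ -R} (fun _ => (1 : ℝ)) x * (Real.exp (-(1 / 2 : ℝ) * (x ⬝ᵥ (Δ *ᵥ x))) / gaussNorm Δ)) :=
          fun i => (hindU i).add (hindL i)
        rw [integral_finsetSum _ fun i _ => hFi i]
        exact Finset.sum_congr rfl fun i _ => integral_add (hindU i) (hindL i)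
    _ ≤ ∑ _i : ι, 2 * Real.exp (-(R ^ 2 / (2 * G))) := Finset.sum_le_sum fun i _ => gauss_twoTails_le hδ hΔ hsymm i hR hG (hGi i)
    _ = 2 * Fintype.card ι * Real.exp (-(R ^ 2 / (2 * G))) := by
        rw [Finset.sum_const, Finset.card_univ, nsmul_eq_mul]; ring

end Summit.QuantumFields.YangMills.BalabanUVNodes.N15KingModelRung.FreeField

end
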